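import Summits.KontsevichZagierPeriods.KontsevichZagierPeriods.Theorems.SymplecticScissorsRealOnePeriodRelationsStubHomotopyInvarianceAux
import Literature.NumberTheory.Transcendental.CurvePeriodsContinuousHomotopyProofs
import Literature.NumberTheory.Transcendental.CurvePeriodsPathHomotopicProofs

/-!
# `RealOnePeriodRelations` (stmt-KontsevichZagierPeriods-10042), line `nash-retraction-thin-strip`,
# stub `stub_homotopyInvariance` — auxiliary file 3: the grid kit

Helpers for the stub `stub_homotopyInvariance` (homotopy coherence in the move world), continued
(registered anchor: `helper_homotopyInvariance_3`, telescoping over the grid in `M₁`):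

* `exists_continuousHomotopy` — a `Path.Homotopic` witness in the subspace `Z(ℂ)` gives a
  continuous homotopy `H : ℝ² → Z(ℂ)` with fixed end points (pattern of the tree's
  `CurvePeriods.span_single_sub_single_of_homotopic`);
* `exists_grid` — a grid of `N × N` cells each mapped by `H` into the open region attached to one
  point of `Z` (Lebesgue number; the tree's `exists_grid_charts` for an arbitrary family of regions);
* `exists_edgeCont` — the continuous edge `link⁻¹ · H-edge · link` inside `Z ∩ G`;
* `realises_chart`, `cell_inputs` — a realisation along a path inside the domain of a graph chart
  `ψ` over `i₀` is a realisation along `ψ ∘ w`, `w = γ_{i₀}`, in the format of the chart cell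
  (`stub_cellGreen`), together with the other three inputs of the cell (`w` is `C¹`, semialgebraic,
  inside the closed disc);
* `sa_const` — constant paths at algebraic points are semialgebraic;
* `telescope_mem` — telescoping of the cell relations over the grid inside `M₁`
  (`CurvePeriods.grid_telescope`).

References: A. Huber, G. Wüstholz, *Transcendence and Linear Relations of 1-Periods* (2022), §3.3.1;
M. Kontsevich, D. Zagier, *Periods* (2001), §1.2.
-/

noncomputable section

open scoped BigOperators Topology unitInterval
open Set MeasureTheory Filter
open Literature.NumberTheory.Transcendental Literature.NumberTheory.Transcendental.CurvePeriods
open Literature.ModelTheory.ExponentialFields (IsSemialgebraic)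
open Summit.KontsevichZagierPeriods.SymplecticScissors.RealOnePeriodRelationsNegative (M₁ unitDom)
open Summit.KontsevichZagierPeriods.Theorems.StuffleInKZ.Negative.LogShadow (isSemialgebraic_Icc01)

namespace Summit.KontsevichZagierPeriods.SymplecticScissors.RealOnePeriodRelations.HomotopyInvariance

/-! ## From `Path.Homotopic` to a continuous homotopy on `ℝ²` -/

/-- A homotopy of paths in the subspace `Z(ℂ)`, extended to `ℝ²` by projection onto the square, is a
continuous homotopy with fixed end points between the two `C¹` paths (pattern of the tree's
`span_single_sub_single_of_homotopic`). [cite: HuberWustholz2022, §3.3.1] -/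
theorem exists_continuousHomotopy {Z : CurveData} {x y : Z.points} {p₀ p₁ : Path x y}
    (hp : p₀.Homotopic p₁) (γ₀ γ₁ : CurvePath Z) (hγ₀ : ∀ t : I, γ₀.toFun t = p₀ t)
    (hγ₁ : ∀ t : I, γ₁.toFun t = p₁ t) :
    ∃ H : ℝ × ℝ → (Fin Z.n → ℂ), Continuous H ∧ (∀ q, H q ∈ Z.points) ∧
      (∀ s, H (s, 0) = H (0, 0)) ∧ (∀ s, H (s, 1) = H (0, 1)) ∧
      (∀ t ∈ Icc (0 : ℝ) 1, γ₀.toFun t = H (0, t)) ∧ (∀ t ∈ Icc (0 : ℝ) 1, γ₁.toFun t = H (1, t)) := by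
  -- adapted from `CurvePeriods.span_single_sub_single_of_homotopic`
  obtain ⟨F⟩ := hp
  let π : ℝ → I := projIcc (0 : ℝ) 1 zero_le_one
  have hπ : Continuous π := continuous_projIcc
  have hπmem : ∀ {t : ℝ} (ht : t ∈ Icc (0 : ℝ) 1), π t = ⟨t, ht⟩ := fun ht => projIcc_of_mem _ ht
  have hπ0 : π 0 = 0 := (hπmem ⟨le_rfl, zero_le_one⟩).trans (Set.Icc.mk_zero _)
  have hπ1 : π 1 = 1 := (hπmem ⟨zero_le_one, le_rfl⟩).trans (Set.Icc.mk_one _)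
  refine ⟨fun q => ((F (π q.1, π q.2) : Z.points) : Fin Z.n → ℂ), ?_, fun q => (F (π q.1, π q.2)).2,
    fun s => ?_, fun s => ?_, fun t ht => ?_, fun t ht => ?_⟩
  · exact continuous_subtype_val.comp
      (F.continuous.comp ((hπ.comp continuous_fst).prodMk (hπ.comp continuous_snd)))
  · show ((F (π s, π 0) : Z.points) : Fin Z.n → ℂ) = F (π 0, π 0)
    rw [hπ0, F.source, F.source]
  · show ((F (π s, π 1) : Z.points) : Fin Z.n → ℂ) = F (π 0, π 1)
    rw [hπ1, F.target, F.target]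
  · show γ₀.toFun t = F (π 0, π t)
    rw [hπ0, hπmem ht, F.apply_zero]
    exact hγ₀ ⟨t, ht⟩
  · show γ₁.toFun t = F (π 1, π t)
    rw [hπ1, hπmem ht, F.apply_one]
    exact hγ₁ ⟨t, ht⟩

/-! ## A grid subordinate to a family of open regions -/

/-- **A grid subordinate to open regions around the points of `Z`** (Lebesgue number): for `H`
continuous on the unit square with values in `Z(ℂ)` and open sets `R z ∋ z` (`z ∈ Z(ℂ)`), there are
`N ≥ 1` and points `zc p q ∈ Z(ℂ)` with `H(cell (p, q)) ⊆ R (zc p q)` for all `p, q < N`.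
[folklore] -/
theorem exists_grid {Z : CurveData} {H : ℝ × ℝ → (Fin Z.n → ℂ)}
    (hH : ContinuousOn H (Icc (0 : ℝ) 1 ×ˢ Icc (0 : ℝ) 1))
    (hHZ : ∀ x ∈ Icc (0 : ℝ) 1 ×ˢ Icc (0 : ℝ) 1, H x ∈ Z.points)
    (R : (Fin Z.n → ℂ) → Set (Fin Z.n → ℂ)) (hRo : ∀ z ∈ Z.points, IsOpen (R z))
    (hzR : ∀ z ∈ Z.points, z ∈ R z) :
    ∃ (N : ℕ) (zc : ℕ → ℕ → (Fin Z.n → ℂ)), 0 < N ∧ ∀ p q, p < N → q < N →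
      zc p q ∈ Z.points ∧ ∀ x ∈ gridCell N p q, H x ∈ R (zc p q) := by
  -- adapted from `CurvePeriods.exists_grid_charts`
  classical
  have hK : IsCompact (Icc (0 : ℝ) 1 ×ˢ Icc (0 : ℝ) 1) := isCompact_Icc.prod isCompact_Icc
  have h00 : ((0 : ℝ), (0 : ℝ)) ∈ Icc (0 : ℝ) 1 ×ˢ Icc (0 : ℝ) 1 :=
    ⟨⟨le_rfl, zero_le_one⟩, ⟨le_rfl, zero_le_one⟩⟩
  have hcov : ∀ s : ↥(Icc (0 : ℝ) 1 ×ˢ Icc (0 : ℝ) 1), ∃ U : Set (ℝ × ℝ), IsOpen U ∧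
      (s : ℝ × ℝ) ∈ U ∧ ∀ x ∈ U, x ∈ Icc (0 : ℝ) 1 ×ˢ Icc (0 : ℝ) 1 → H x ∈ R (H s) := by
    intro s
    have hs : H s ∈ Z.points := hHZ s s.2
    obtain ⟨U, hUo, hU⟩ := (_root_.continuousOn_iff'.mp hH) (R (H s)) (hRo _ hs)
    refine ⟨U, hUo, ?_, fun x hxU hx => ?_⟩
    · have : (s : ℝ × ℝ) ∈ H ⁻¹' R (H s) ∩ Icc (0 : ℝ) 1 ×ˢ Icc (0 : ℝ) 1 := ⟨hzR _ hs, s.2⟩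
      rw [hU] at this
      exact this.1
    · have : x ∈ U ∩ Icc (0 : ℝ) 1 ×ˢ Icc (0 : ℝ) 1 := ⟨hxU, hx⟩
      rw [← hU] at this
      exact this.1
  choose U hUo hsU hU using hcov
  obtain ⟨δ, hδ, hleb⟩ := lebesgue_number_lemma_of_metric hK hUo
    (fun x hx => mem_iUnion.mpr ⟨⟨x, hx⟩, hsU ⟨x, hx⟩⟩)
  obtain ⟨N₀, hN₀⟩ := exists_nat_one_div_lt hδ
  set N : ℕ := N₀ + 1 with hN
  have hNpos : 0 < N := Nat.succ_pos N₀
  have hN' : (0 : ℝ) < N := by exact_mod_cast hNpos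
  have hNinv : 1 / (N : ℝ) < δ := by rw [hN]; exact_mod_cast hN₀
  have hcellK : ∀ p q, p < N → q < N →
      ((p : ℝ) / N, (q : ℝ) / N) ∈ Icc (0 : ℝ) 1 ×ˢ Icc (0 : ℝ) 1 :=
    fun p q hp hq => gridCell_subset_square hNpos hp hq
      ⟨⟨le_rfl, div_le_div_of_nonneg_right (by linarith) hN'.le⟩,
        ⟨le_rfl, div_le_div_of_nonneg_right (by linarith) hN'.le⟩⟩
  have hidx : ∀ p q, p < N → q < N → ∃ s : ↥(Icc (0 : ℝ) 1 ×ˢ Icc (0 : ℝ) 1),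
      ∀ x ∈ gridCell N p q, H x ∈ R (H s) := by
    intro p q hp hq
    obtain ⟨s, hs⟩ := hleb _ (hcellK p q hp hq)
    refine ⟨s, fun x hx => hU s x (hs ?_) (gridCell_subset_square hNpos hp hq hx)⟩
    rw [Metric.mem_ball]
    exact lt_of_le_of_lt (dist_le_of_mem_gridCell hNpos hx) hNinv
  haveI : Nonempty ↥(Icc (0 : ℝ) 1 ×ˢ Icc (0 : ℝ) 1) := ⟨⟨_, h00⟩⟩
  choose! s hs using hidx
  exact ⟨N, fun p q => H (s p q), hNpos, fun p q hp hq => ⟨hHZ _ (s p q).2, hs p q hp hq⟩⟩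

/-! ## Continuous edges of the grid -/

/-- **A continuous edge from three pieces**: a link `a → v`, a continuous path `v → v′` and a
reversed link `a′ → v′`, all inside `Z ∩ G`, give a continuous path from `a` to `a′` inside
`Z ∩ G` (to be replaced by a semialgebraic `C¹` path by `stub_saPathSubset`). [folklore] -/
theorem exists_edgeCont {Z : CurveData} {G : Set (Fin Z.n → ℂ)} {a v v' a' : Fin Z.n → ℂ}
    (κ : ℝ → (Fin Z.n → ℂ)) (hκ : Continuous κ) (hκ0 : κ 0 = a) (hκ1 : κ 1 = v)
    (hκZ : ∀ t, κ t ∈ Z.points) (hκG : ∀ t, κ t ∈ G)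
    (e : ℝ → (Fin Z.n → ℂ)) (he : Continuous e) (he0 : e 0 = v) (he1 : e 1 = v')
    (heZ : ∀ t ∈ Icc (0 : ℝ) 1, e t ∈ Z.points) (heG : ∀ t ∈ Icc (0 : ℝ) 1, e t ∈ G)
    (κ' : ℝ → (Fin Z.n → ℂ)) (hκ' : Continuous κ') (hκ'0 : κ' 0 = a') (hκ'1 : κ' 1 = v')
    (hκ'Z : ∀ t, κ' t ∈ Z.points) (hκ'G : ∀ t, κ' t ∈ G) :
    ∃ c : ℝ → (Fin Z.n → ℂ), Continuous c ∧ c 0 = a ∧ c 1 = a' ∧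
      (∀ t ∈ Icc (0 : ℝ) 1, c t ∈ Z.points) ∧ ∀ t ∈ Icc (0 : ℝ) 1, c t ∈ G := by
  -- adapted from `CurvePeriods.exists_edgePath`
  set c : ℝ → (Fin Z.n → ℂ) := fun t =>
    if t ≤ 1 / 3 then κ (3 * t) else if t ≤ 2 / 3 then e (3 * t - 1) else κ' (1 - (3 * t - 2)) with hc
  have hcont : Continuous c :=
    continuous_concat3 hκ he (hκ'.comp (continuous_const.sub continuous_id)) (by rw [hκ1, he0])
      (by show e 1 = κ' (1 - 0); rw [sub_zero, hκ'1, he1])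
  have hc0 : c 0 = a := by
    show (if (0 : ℝ) ≤ 1 / 3 then κ (3 * 0) else
      if (0 : ℝ) ≤ 2 / 3 then e (3 * 0 - 1) else κ' (1 - (3 * 0 - 2))) = a
    rw [if_pos (by norm_num), mul_zero, hκ0]
  have hc1 : c 1 = a' := by
    show (if (1 : ℝ) ≤ 1 / 3 then κ (3 * 1) else
      if (1 : ℝ) ≤ 2 / 3 then e (3 * 1 - 1) else κ' (1 - (3 * 1 - 2))) = a'
    rw [if_neg (by norm_num), if_neg (by norm_num)]
    norm_num [hκ'0]
  refine ⟨c, hcont, hc0, hc1, fun t ht => ?_, fun t ht => ?_⟩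
  · exact concat3_mem (S := Z.points) (fun t _ => hκZ t) heZ (fun t _ => hκ'Z _) t ht
  · exact concat3_mem (S := G) (fun t _ => hκG t) heG (fun t _ => hκ'G _) t ht

/-! ## The chart form of a realisation inside one chart -/

/-- **Realisations in chart form.** If a path `σ` stays in the domain of a graph chart `ψ` over
the coordinate `i₀` (`ψ(g(u)_{i₀}) = g(u)` on `[0,1]`), its realisation integrand is the realisation
integrand of `ψ ∘ w`, `w = g_{i₀}` — the format of the chart-cell hypothesis (`stub_cellGreen`).
[folklore] -/
theorem realises_chart {n : ℕ} {ψ : ℂ → (Fin n → ℂ)} {g : ℝ → (Fin n → ℂ)} {i₀ : Fin n}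
    (hψg : ∀ u ∈ Icc (0 : ℝ) 1, ψ (g u i₀) = g u) {a : ℂ} {ω : Fin n → MvPolynomial (Fin n) ℂ}
    {R : KZ.IntegralRep 1}
    (hR : R.domain = {z | z 0 ∈ Set.Ioo (0 : ℝ) 1} ∧ ∀ z ∈ R.domain, R.integrand z =
      (a * ∑ i, MvPolynomial.eval (g (z 0)) (ω i) * deriv (fun u => g u i) (z 0)).re) :
    R.domain = {z | z 0 ∈ Set.Ioo (0 : ℝ) 1} ∧ ∀ z ∈ R.domain, R.integrand z =
      (a * ∑ i, MvPolynomial.eval (ψ (g (z 0) i₀)) (ω i) *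
        deriv (fun u => ψ (g u i₀) i) (z 0)).re := by
  refine ⟨hR.1, fun z hz => ?_⟩
  have hz' : z 0 ∈ Ioo (0 : ℝ) 1 := by
    have := hz; rw [hR.1] at this; exact this
  rw [hR.2 z hz, hψg _ (Ioo_subset_Icc_self hz')]
  congr 2
  refine Finset.sum_congr rfl fun i _ => ?_
  congr 1
  refine Filter.EventuallyEq.deriv_eq ?_
  filter_upwards [Icc_mem_nhds hz'.1 hz'.2] with u hu
  rw [hψg u hu]

/-- Constant paths at algebraic points are semialgebraic. [cite: KontsevichZagier2001, §1.1] -/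
theorem sa_const {n : ℕ} {P : Fin n → ℂ} (hP : ∀ i, IsAlgebraic ℚ (P i)) :
    IsSemialgebraicMapOn ℚ {z : Fin 1 → ℝ | z 0 ∈ Set.Icc (0 : ℝ) 1}
      (fun z => Fin.append (fun i => ((fun _ : ℝ => P) (z 0) i).re)
        (fun i => ((fun _ : ℝ => P) (z 0) i).im)) := by
  have hC : ∀ j : Fin (n + n),
      IsAlgebraic ℚ (Fin.append (fun i => (P i).re) (fun i => (P i).im) j) := by
    intro j
    refine Fin.addCases (motive := fun j =>
      IsAlgebraic ℚ (Fin.append (fun i => (P i).re) (fun i => (P i).im) j)) (fun i => ?_)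
      (fun i => ?_) j
    · rw [Fin.append_left]; exact (isAlgebraic_re_im (hP i)).1
    · rw [Fin.append_right]; exact (isAlgebraic_re_im (hP i)).2
  refine IsSemialgebraicMapOn.of_forall isSemialgebraic_Icc01 fun j => ?_
  exact isSemialgebraicFunOn_const_of_isAlgebraic isSemialgebraic_Icc01 (hC j)

/-! ## Telescoping over the grid in `M₁` -/

/-- **Telescoping**: if every cell combination `b(p,q) + l(p+1,q) − b(p,q+1) − l(p,q)` lies in
`M₁` and so do the bottom and top edges, then `Σ_q l(N,q) − Σ_q l(0,q) ∈ M₁`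
(`CurvePeriods.grid_telescope`). [cite: HuberWustholz2022, §3.3.1] -/
theorem telescope_mem (b l : ℕ → ℕ → KZ.FormalRep) (N : ℕ)
    (hcell : ∀ p q, p < N → q < N → b p q + l (p + 1) q - b p (q + 1) - l p q ∈ M₁)
    (hbot : ∀ p, p < N → b p 0 ∈ M₁) (htop : ∀ p, p < N → b p N ∈ M₁) :
    ∑ q ∈ Finset.range N, l N q - ∑ q ∈ Finset.range N, l 0 q ∈ M₁ := by
  have hS : ∑ p ∈ Finset.range N, ∑ q ∈ Finset.range N,
      (b p q + l (p + 1) q - b p (q + 1) - l p q) ∈ M₁ :=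
    sum_mem fun p hp => sum_mem fun q hq =>
      hcell p q (Finset.mem_range.mp hp) (Finset.mem_range.mp hq)
  rw [grid_telescope] at hS
  have hB : ∑ p ∈ Finset.range N, (b p 0 - b p N) ∈ M₁ :=
    sum_mem fun p hp => M₁.sub_mem (hbot p (Finset.mem_range.mp hp))
      (htop p (Finset.mem_range.mp hp))
  have := M₁.sub_mem hS hB
  rw [add_sub_cancel_left, Finset.sum_sub_distrib] at this
  exact this

/-! ## The inputs of the chart cell for one edge -/

/-- **The four data of an edge for the chart cell** (`stub_cellGreen`): for a semialgebraic `C¹`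
path `g` on `Z` inside the region `Ω ∩ {z | z_{i₀} ∈ B(c, ρ/4)}` of a graph chart `ψ` over `i₀`,
the chart-coordinate path `w = g_{i₀}` is `C¹`, semialgebraic, stays in the closed disc
`B̄(c, ρ/4)`, and every realisation of `a · ω` along `g` is a realisation along `ψ ∘ w` in chart
form. [cite: HuberWustholz2022, §3.3.1] -/
theorem cell_inputs {Z : CurveData} {i₀ : Fin Z.n} {c : ℂ} {ε ρ : ℝ} {Ω : Set (Fin Z.n → ℂ)}
    {ψ : ℂ → (Fin Z.n → ℂ)} (h1 : ∀ z ∈ Ω, z ∈ Z.points → z i₀ ∈ Metric.ball c ε ∧ ψ (z i₀) = z)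
    (g : CurvePath Z)
    (hsa : IsSemialgebraicMapOn ℚ {z : Fin 1 → ℝ | z 0 ∈ Set.Icc (0 : ℝ) 1}
      (fun z => Fin.append (fun i => (g.toFun (z 0) i).re) (fun i => (g.toFun (z 0) i).im)))
    (hg : ∀ t ∈ Icc (0 : ℝ) 1, g.toFun t ∈ Ω ∩ {z' | z' i₀ ∈ Metric.ball c (ρ / 4)})
    {a : ℂ} {ω : Fin Z.n → MvPolynomial (Fin Z.n) ℂ} {R : KZ.IntegralRep 1}
    (hR : R.domain = {z | z 0 ∈ Set.Ioo (0 : ℝ) 1} ∧ ∀ z ∈ R.domain, R.integrand z =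
      (a * ∑ i, MvPolynomial.eval (g.toFun (z 0)) (ω i) * deriv (fun u => g.toFun u i) (z 0)).re) :
    ContDiffOn ℝ 1 (fun t => g.toFun t i₀) (Set.Icc 0 1) ∧
    IsSemialgebraicMapOn ℚ {z : Fin 1 → ℝ | z 0 ∈ Set.Icc (0 : ℝ) 1}
      (fun z => ![(g.toFun (z 0) i₀).re, (g.toFun (z 0) i₀).im]) ∧
    (∀ t ∈ Set.Icc (0 : ℝ) 1, g.toFun t i₀ ∈ Metric.closedBall c (ρ / 4)) ∧
    (R.domain = {z | z 0 ∈ Set.Ioo (0 : ℝ) 1} ∧ ∀ z ∈ R.domain, R.integrand z =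
      (a * ∑ i, MvPolynomial.eval (ψ (g.toFun (z 0) i₀)) (ω i) *
        deriv (fun u => ψ (g.toFun u i₀) i) (z 0)).re) :=
  ⟨g.contDiffOn_apply i₀, sa_coord hsa i₀, fun t ht => Metric.ball_subset_closedBall (hg t ht).2,
    realises_chart (fun u hu => (h1 _ (hg u hu).1 (g.mem_points u hu)).2) hR⟩

end Summit.KontsevichZagierPeriods.SymplecticScissors.RealOnePeriodRelations.HomotopyInvariance

namespace Summit.KontsevichZagierPeriods.SymplecticScissors.RealOnePeriodRelations

/-- **Registered anchor `helper_homotopyInvariance_3` (TELESCOPING OVER THE GRID IN `M₁`).** If every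
cell combination `b(p,q) + l(p+1,q) − b(p,q+1) − l(p,q)` and every bottom and top edge `b(p,0)`,
`b(p,N)` lies in `M₁`, then `Σ_q l(N,q) − Σ_q l(0,q) ∈ M₁`. [cite: HuberWustholz2022, §3.3.1] -/
theorem helper_homotopyInvariance_3 : ∀ (b l : ℕ → ℕ → KZ.FormalRep) (N : ℕ), (∀ p q, p < N → q < N → b p q + l (p + 1) q - b p (q + 1) - l p q ∈ M₁) → (∀ p, p < N → b p 0 ∈ M₁) → (∀ p, p < N → b p N ∈ M₁) → ∑ q ∈ Finset.range N, l N q - ∑ q ∈ Finset.range N, l 0 q ∈ M₁ :=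
  fun b l N hcell hbot htop => HomotopyInvariance.telescope_mem b l N hcell hbot htop

end Summit.KontsevichZagierPeriods.SymplecticScissors.RealOnePeriodRelations

end
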